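import Literature.AnabelianGeometry.AbsoluteAnabelian.AbsTopIII.Thm19KummerContainerPartsProofs
import HarnessLib

/-!
# [AbsTopIII] Thm. 1.9 (d): the embeddings "`k̄_NF^× ↪ lim`", "`K_{Z_NF}^× ↪ lim`" and the closers of
# `Thm19d_constants` / `Thm19d_functionField` under the interface laws

Mochizuki, *Topics in Absolute Anabelian Geometry III*, §1, Theorem 1.9 (d), manuscript pp. 37–38
(lit key `paper:url-5493eb38cbb7`): "one constructs the subgroups
`k̄_NF^× ⊆ K_{Z_NF}^× ↪ lim_{→V} H¹(Π_V, μ_Ẑ(Π_U))` [...] the '`↪`' arises from the Kummer map".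

Proof-only sequel of `Thm19KummerContainerPartsProofs.lean` (abc-iut-w5-d213; sub-DAG
`plan/L4/SUBDAG-AbsTopIII-Thm19.md`, rows Thm19.d.r9 / r10; cell abc-iut, abc-iut-L4-lead RULINGS #3f (3)).
There the SET halves of the named statements were proved under explicit interface-law binders.  Here the
EMBEDDING halves are CONSTRUCTED — not assumed — from the remaining interface data the tree's
`CurveModel` / `IntrinsicKummerModel` do not carry (cell GAP-LEDGER G-w5d213-2, exact statements = the
binders below), together with the injectivity row `Thm19d_inj` (abc-iut-w5-d099, `thm19d_inj_of_naturality`)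
consumed BY NAME:

* "`k̄_NF^× ↪ lim`": from the TOWER OF BASE FIELDS of the levels inside `k̄` — embeddings
  `τ_i : k′_i → k̄ = AlgebraicClosure k_Z` compatible with the unit restrictions `ρ`, exhausting `k̄_NF`
  (the `k′` range over all finite extensions), with "NF-constant ⟺ lands in `k̄_NF`" (Def. 1.7 (ii)) and
  "constants are regular units" — the map `c ↦` (class of `κ_{V_j}(c)` for any level `j` with `c ∈ k′_j`) is a
  well-defined (`kummerToContainer_const_eq_of_tau_eq`, via the naturality of the Kummer maps) injective
  homomorphism with image `nfConstantImage S` (`exists_constEmbedding`);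
* "`K_{Z_NF}^× ↪ lim`": from the TOWER OF FUNCTION FIELDS — embeddings `σ_i : K_{V_i} → Ω`, `σ_Z : K_{Z_NF} → Ω`
  into a common field (at the intended model `Ω = K_{Z ×_{k_Z} k̄}`) compatible with `ρ`, with "NF-rational ⟺
  lands in `σ_Z(K_{Z_NF})`" (Def. 1.7 (ii)) and the EVENTUAL regularity of every `f ∈ K_{Z_NF}^×` (its zeros and
  poles are NF-points, removed at some level; `f` is defined over some `k′`) — the analogous construction
  (`kummerToContainer_eq_of_sigma_eq`, `exists_functionFieldEmbedding`);
* the closers `thm19d_constants_of_laws`, `thm19d_functionField_of_laws`: the NAMED statements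
  `IntrinsicKummerModel.Thm19d_constants` / `Thm19d_functionField` from abc-iut-L4-t1's named facts
  `Prop_1_8_i`, `Prop_1_8_ii`, `Prop_1_6_iii_units`, `Prop_1_6_iii_ker`, `Rmk_1_5_4_i`, the sibling row
  `Thm19d_inj`, and the interface laws as ONE explicit hypothesis per statement (data + laws per directed
  system, Lean-signature form; never a new def).

No definition, no new named fact.  HONEST FRAMING: the binders are interface identifications true at the
intended étale-`π₁` model and not derivable from the tree's interfaces; typed ≠ proved for them; nothing here
bears on [IUTchIII] Cor. 3.12.
-/

noncomputable section

open CategoryTheory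
open scoped Classical

namespace Literature.AnabelianGeometry.AbsoluteAnabelian.AbsTopIII

universe u

namespace IntrinsicKummerModel

variable (M : IntrinsicKummerModel.{u}) {Z : M.Curve} {ι : Type u} [Preorder ι]
  (S : CurveModel.NFComplementSystem M.toCurveModel Z ι)

/-! ### "`k̄_NF^× ↪ lim`": the embedding of the NF-constants -/

section Constants

variable (ρ : ∀ ⦃i j : ι⦄, i ≤ j → (Additive (M.regularUnits (S.V i)) →+ Additive (M.regularUnits (S.V j))))
  (hnat : ∀ ⦃i j : ι⦄ (h : i ≤ j) (f : Additive (M.regularUnits (S.V i))),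
    S.transition i j h (M.kummerLevel S i f) = M.kummerLevel S j (ρ h f))
  (hcreg : ∀ (i : ι) (c : (M.base (S.V i))ˣ),
    Units.map (algebraMap (M.base (S.V i)) (M.FunctionField (S.V i)) : _ →* _) c ∈ M.regularUnits (S.V i))
  (τ : ∀ i : ι, M.base (S.V i) →+* AlgebraicClosure (M.base Z))
  (hτρ : ∀ ⦃i j : ι⦄ (h : i ≤ j) (c : (M.base (S.V i))ˣ), ∃ c' : (M.base (S.V j))ˣ,
    τ j (c' : M.base (S.V j)) = τ i (c : M.base (S.V i)) ∧
      ρ h (Additive.ofMul ⟨_, hcreg i c⟩) = Additive.ofMul ⟨_, hcreg j c'⟩)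

include ρ hnat hcreg τ hτρ

/-- WELL-DEFINEDNESS of "`c ↦ κ_{V_j}(c)` in the container": two constants of two levels with the same
image in `k̄` have the same Kummer class in `lim_{→V} H¹(Π_V, M_Z)` (move both to a common deeper level by
the unit restrictions; naturality of the Kummer maps; injectivity of `k′_k → k̄`).
[cite: MochizukiAbsTopIII2015, Thm 1.9 (d) p.38] -/
theorem kummerToContainer_const_eq_of_tau_eq [IsDirectedOrder ι] {j j' : ι} (c : (M.base (S.V j))ˣ)
    (c' : (M.base (S.V j'))ˣ) (h : τ j (c : M.base (S.V j)) = τ j' (c' : M.base (S.V j'))) :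
    M.kummerToContainer S j (Additive.ofMul ⟨_, hcreg j c⟩) =
      M.kummerToContainer S j' (Additive.ofMul ⟨_, hcreg j' c'⟩) := by
  obtain ⟨k, hjk, hj'k⟩ := exists_ge_ge j j'
  obtain ⟨c₁, hc₁, hρ₁⟩ := hτρ hjk c
  obtain ⟨c₁', hc₁', hρ₁'⟩ := hτρ hj'k c'
  have hcc : c₁ = c₁' := by
    apply Units.ext
    apply (τ k).injective
    rw [hc₁, hc₁', h]
  rw [← kummerToContainer_restrict ρ hnat hjk, ← kummerToContainer_restrict ρ hnat hj'k, hρ₁, hρ₁', hcc]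

variable (hτNF : ∀ (i : ι) (c : (M.base (S.V i))ˣ),
    M.IsNFConstant (S.V i) (c : M.base (S.V i)) ↔ τ i (c : M.base (S.V i)) ∈ M.kbarNF Z)
  (hτexh : ∀ (i : ι) (a : AlgebraicClosure (M.base Z)), a ∈ M.kbarNF Z →
    ∃ j : ι, i ≤ j ∧ a ∈ Set.range (τ j))
  (hinjS : ∀ i : ι, Function.Injective (M.kummerToContainer S i))

include hτNF hτexh hinjS

/-- **"`k̄_NF^× ↪ lim_{→V} H¹(Π_V, μ_Ẑ(Π_U))`" CONSTRUCTED** from the tower of base fields of the levels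
(`τ`, compatible with the unit restrictions `ρ`, exhausting `k̄_NF`, detecting NF-constants), the naturality
of the Kummer maps and the levelwise injectivity of the Kummer maps into the container (`Thm19d_inj`): an
injective homomorphism with image exactly the Kummer classes of the NF-constants of the levels.
[cite: MochizukiAbsTopIII2015, Thm 1.9 (d) p.38] -/
theorem exists_constEmbedding [Nonempty ι] [IsDirectedOrder ι] :
    ∃ e : Additive (↥(M.kbarNF Z))ˣ →+ S.kummerContainer,
      Function.Injective e ∧ Set.range e = M.nfConstantImage S := by
  classical
  obtain ⟨i₀⟩ := ‹Nonempty ι›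
  -- every unit of `k̄_NF` is represented by a unit of the base field of some level
  have hrep : ∀ a : (↥(M.kbarNF Z))ˣ, ∃ (j : ι) (c : (M.base (S.V j))ˣ),
      τ j (c : M.base (S.V j)) = ((a : ↥(M.kbarNF Z)) : AlgebraicClosure (M.base Z)) := by
    intro a
    obtain ⟨j, -, c₀, hc₀⟩ := hτexh i₀ _ (a : ↥(M.kbarNF Z)).2
    have hc₀0 : c₀ ≠ 0 := by
      rintro rfl
      apply Units.ne_zero a
      exact Subtype.ext (by rw [← hc₀, map_zero]; rfl)
    exact ⟨j, Units.mk0 c₀ hc₀0, by rw [Units.val_mk0, hc₀]⟩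
  choose J C hJC using hrep
  -- the candidate map; it does not depend on the chosen representation
  let e₀ : (↥(M.kbarNF Z))ˣ → S.kummerContainer := fun a =>
    M.kummerToContainer S (J a) (Additive.ofMul ⟨_, hcreg (J a) (C a)⟩)
  have he₀ : ∀ (a : (↥(M.kbarNF Z))ˣ) (j : ι) (c : (M.base (S.V j))ˣ),
      τ j (c : M.base (S.V j)) = ((a : ↥(M.kbarNF Z)) : AlgebraicClosure (M.base Z)) →
      e₀ a = M.kummerToContainer S j (Additive.ofMul ⟨_, hcreg j c⟩) :=
    fun a j c hc => M.kummerToContainer_const_eq_of_tau_eq S ρ hnat hcreg τ hτρ (C a) c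
      (by rw [hJC a, hc])
  -- multiplicativity: move both representatives to a common level
  have hmul : ∀ x y : (↥(M.kbarNF Z))ˣ, e₀ (x * y) = e₀ x + e₀ y := by
    intro x y
    obtain ⟨k, hxk, hyk⟩ := exists_ge_ge (J x) (J y)
    obtain ⟨c₁, hc₁, -⟩ := hτρ hxk (C x)
    obtain ⟨c₂, hc₂, -⟩ := hτρ hyk (C y)
    have hxy : τ k ((c₁ * c₂ : (M.base (S.V k))ˣ) : M.base (S.V k)) =
        (((x * y : (↥(M.kbarNF Z))ˣ) : ↥(M.kbarNF Z)) : AlgebraicClosure (M.base Z)) := by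
      rw [Units.val_mul, map_mul, hc₁, hc₂, hJC x, hJC y]
      rfl
    rw [he₀ (x * y) k (c₁ * c₂) hxy, he₀ x k c₁ (by rw [hc₁, hJC x]),
      he₀ y k c₂ (by rw [hc₂, hJC y])]
    have hm : (⟨_, hcreg k (c₁ * c₂)⟩ : M.regularUnits (S.V k)) =
        ⟨_, hcreg k c₁⟩ * ⟨_, hcreg k c₂⟩ := Subtype.ext (by simp)
    rw [hm, ofMul_mul, map_add]
  refine ⟨AddMonoidHom.mk' (fun a => e₀ (Additive.toMul a)) fun a b => hmul _ _, ?_, ?_⟩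
  · -- injectivity: `κ_{V_j}(c) = 0 ⟹ c = 1` by `Thm19d_inj` and the injectivity of `k′_j → K_{V_j}`
    refine (injective_iff_map_eq_zero _).2 fun a ha => ?_
    obtain ⟨x, rfl⟩ : ∃ x, Additive.ofMul x = a := ⟨Additive.toMul a, rfl⟩
    simp only [AddMonoidHom.mk'_apply, toMul_ofMul] at ha
    have h0 : Additive.ofMul (⟨_, hcreg (J x) (C x)⟩ : M.regularUnits (S.V (J x))) = 0 :=
      hinjS (J x) (ha.trans (map_zero _).symm)
    have h1 : (⟨_, hcreg (J x) (C x)⟩ : M.regularUnits (S.V (J x))) = 1 := ofMul_eq_zero.1 h0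
    have h3 := congrArg Subtype.val h1
    have h4 : (C x : M.base (S.V (J x))) = 1 :=
      (algebraMap (M.base (S.V (J x))) (M.FunctionField (S.V (J x)))).injective
        (by simpa using congrArg Units.val h3)
    have h5 : ((x : ↥(M.kbarNF Z)) : AlgebraicClosure (M.base Z)) = 1 := by
      rw [← hJC x, h4, map_one]
    have h6 : x = 1 := Units.ext (Subtype.ext h5)
    rw [h6, ofMul_one]
  · -- the image is `nfConstantImage S`
    ext ξ
    simp only [Set.mem_range, AddMonoidHom.mk'_apply]
    constructor
    · rintro ⟨a, rfl⟩
      generalize Additive.toMul a = x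
      refine ⟨J x, C x, hcreg (J x) (C x), (hτNF (J x) (C x)).2 ?_, rfl⟩
      rw [hJC x]
      exact (x : ↥(M.kbarNF Z)).2
    · rintro ⟨i, c, hc, hcNF, rfl⟩
      have hmem : τ i (c : M.base (S.V i)) ∈ M.kbarNF Z := (hτNF i c).1 hcNF
      have hne : (⟨τ i (c : M.base (S.V i)), hmem⟩ : ↥(M.kbarNF Z)) ≠ 0 := by
        intro h0
        have h1 : τ i (c : M.base (S.V i)) = 0 := congrArg Subtype.val h0
        exact c.ne_zero ((τ i).injective (by rw [h1, map_zero]))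
      exact ⟨Additive.ofMul (Units.mk0 _ hne), he₀ (Units.mk0 _ hne) i c rfl⟩

end Constants

/-! ### "`K_{Z_NF}^× ↪ lim`": the embedding of the NF-rational functions -/

section FunctionField

variable (ρ : ∀ ⦃i j : ι⦄, i ≤ j → (Additive (M.regularUnits (S.V i)) →+ Additive (M.regularUnits (S.V j))))
  (hnat : ∀ ⦃i j : ι⦄ (h : i ≤ j) (f : Additive (M.regularUnits (S.V i))),
    S.transition i j h (M.kummerLevel S i f) = M.kummerLevel S j (ρ h f))
  (Ω : Type u) [Field Ω] (σ : ∀ i : ι, M.FunctionField (S.V i) →+* Ω)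
  (hσρ : ∀ ⦃i j : ι⦄ (h : i ≤ j) (f : M.regularUnits (S.V i)),
    σ j (((Additive.toMul (ρ h (Additive.ofMul f)) : M.regularUnits (S.V j)) :
      (M.FunctionField (S.V j))ˣ) : M.FunctionField (S.V j)) =
      σ i ((f : (M.FunctionField (S.V i))ˣ) : M.FunctionField (S.V i)))

include ρ hnat σ hσρ

/-- WELL-DEFINEDNESS of "`f ↦ κ_{V_j}(f)` in the container": two regular units of two levels with the same
image in the common function field `Ω` have the same Kummer class in `lim_{→V} H¹(Π_V, M_Z)` (move both to a
common deeper level; naturality of the Kummer maps; injectivity of `K_{V_k} → Ω`).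
[cite: MochizukiAbsTopIII2015, Thm 1.9 (d) p.38] -/
theorem kummerToContainer_eq_of_sigma_eq [IsDirectedOrder ι] {j j' : ι} (f : M.regularUnits (S.V j))
    (f' : M.regularUnits (S.V j'))
    (h : σ j ((f : (M.FunctionField (S.V j))ˣ) : M.FunctionField (S.V j)) =
      σ j' ((f' : (M.FunctionField (S.V j'))ˣ) : M.FunctionField (S.V j'))) :
    M.kummerToContainer S j (Additive.ofMul f) = M.kummerToContainer S j' (Additive.ofMul f') := by
  obtain ⟨k, hjk, hj'k⟩ := exists_ge_ge j j'
  have hval : σ k (((Additive.toMul (ρ hjk (Additive.ofMul f)) : M.regularUnits (S.V k)) :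
      (M.FunctionField (S.V k))ˣ) : M.FunctionField (S.V k)) =
      σ k (((Additive.toMul (ρ hj'k (Additive.ofMul f')) : M.regularUnits (S.V k)) :
        (M.FunctionField (S.V k))ˣ) : M.FunctionField (S.V k)) := by
    rw [hσρ hjk f, hσρ hj'k f', h]
  have heq : ρ hjk (Additive.ofMul f) = ρ hj'k (Additive.ofMul f') :=
    Additive.toMul.injective (Subtype.ext (Units.ext ((σ k).injective hval)))
  rw [← kummerToContainer_restrict ρ hnat hjk, ← kummerToContainer_restrict ρ hnat hj'k, heq]

variable (σZ : M.NFFunctionField Z →+* Ω)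
  (hσNF : ∀ (i : ι) (g : M.FunctionField (S.V i)), M.IsNFRational (S.V i) g ↔ σ i g ∈ Set.range σZ)
  (hσexh : ∀ (i : ι) (a : M.NFFunctionField Z), a ≠ 0 → ∃ j : ι, i ≤ j ∧
    ∃ f : M.regularUnits (S.V j), σ j ((f : (M.FunctionField (S.V j))ˣ) : M.FunctionField (S.V j)) = σZ a)
  (hinjS : ∀ i : ι, Function.Injective (M.kummerToContainer S i))

include σZ hσNF hσexh hinjS

/-- **"`K_{Z_NF}^× ↪ lim_{→V} H¹(Π_V, μ_Ẑ(Π_U))`" CONSTRUCTED** from the tower of function fields of the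
levels inside a common field (`σ`, `σ_Z`, compatible with the unit restrictions, detecting NF-rationality,
every element of `K_{Z_NF}^×` eventually a regular unit of a level), the naturality of the Kummer maps and
the levelwise injectivity `Thm19d_inj`: an injective homomorphism with image exactly the Kummer classes of the
NF-rational regular units of the levels. [cite: MochizukiAbsTopIII2015, Thm 1.9 (d) p.38] -/
theorem exists_functionFieldEmbedding [Nonempty ι] [IsDirectedOrder ι] :
    ∃ e : Additive (M.NFFunctionField Z)ˣ →+ S.kummerContainer,
      Function.Injective e ∧ Set.range e = M.nfRationalImage S := by
  classical
  obtain ⟨i₀⟩ := ‹Nonempty ι›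
  have hrep : ∀ a : (M.NFFunctionField Z)ˣ, ∃ (j : ι) (f : M.regularUnits (S.V j)),
      σ j ((f : (M.FunctionField (S.V j))ˣ) : M.FunctionField (S.V j)) = σZ (a : M.NFFunctionField Z) :=
    fun a => by
      obtain ⟨j, -, f, hf⟩ := hσexh i₀ (a : M.NFFunctionField Z) a.ne_zero
      exact ⟨j, f, hf⟩
  choose J F hJF using hrep
  let e₀ : (M.NFFunctionField Z)ˣ → S.kummerContainer := fun a =>
    M.kummerToContainer S (J a) (Additive.ofMul (F a))
  have he₀ : ∀ (a : (M.NFFunctionField Z)ˣ) (j : ι) (f : M.regularUnits (S.V j)),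
      σ j ((f : (M.FunctionField (S.V j))ˣ) : M.FunctionField (S.V j)) = σZ (a : M.NFFunctionField Z) →
      e₀ a = M.kummerToContainer S j (Additive.ofMul f) :=
    fun a j f hf => M.kummerToContainer_eq_of_sigma_eq S ρ hnat Ω σ hσρ (F a) f (by rw [hJF a, hf])
  have hmul : ∀ x y : (M.NFFunctionField Z)ˣ, e₀ (x * y) = e₀ x + e₀ y := by
    intro x y
    obtain ⟨k, hxk, hyk⟩ := exists_ge_ge (J x) (J y)
    set f₁ : M.regularUnits (S.V k) := Additive.toMul (ρ hxk (Additive.ofMul (F x))) with hf₁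
    set f₂ : M.regularUnits (S.V k) := Additive.toMul (ρ hyk (Additive.ofMul (F y))) with hf₂
    have h₁ : σ k ((f₁ : (M.FunctionField (S.V k))ˣ) : M.FunctionField (S.V k)) =
        σZ (x : M.NFFunctionField Z) := by rw [hf₁, hσρ hxk (F x), hJF x]
    have h₂ : σ k ((f₂ : (M.FunctionField (S.V k))ˣ) : M.FunctionField (S.V k)) =
        σZ (y : M.NFFunctionField Z) := by rw [hf₂, hσρ hyk (F y), hJF y]
    have hxy : σ k (((f₁ * f₂ : M.regularUnits (S.V k)) : (M.FunctionField (S.V k))ˣ) :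
        M.FunctionField (S.V k)) = σZ ((x * y : (M.NFFunctionField Z)ˣ) : M.NFFunctionField Z) := by
      rw [Subgroup.coe_mul, Units.val_mul, map_mul, h₁, h₂, Units.val_mul, map_mul]
    rw [he₀ (x * y) k (f₁ * f₂) hxy, he₀ x k f₁ h₁, he₀ y k f₂ h₂, ofMul_mul, map_add]
  refine ⟨AddMonoidHom.mk' (fun a => e₀ (Additive.toMul a)) fun a b => hmul _ _, ?_, ?_⟩
  · -- injectivity: `κ_{V_j}(f) = 0 ⟹ f = 1` by `Thm19d_inj`, and `σ_Z` is injective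
    refine (injective_iff_map_eq_zero _).2 fun a ha => ?_
    obtain ⟨x, rfl⟩ : ∃ x, Additive.ofMul x = a := ⟨Additive.toMul a, rfl⟩
    simp only [AddMonoidHom.mk'_apply, toMul_ofMul] at ha
    have h0 : Additive.ofMul (F x) = 0 := hinjS (J x) (ha.trans (map_zero _).symm)
    have h1 : F x = 1 := ofMul_eq_zero.1 h0
    have h2 : σZ (x : M.NFFunctionField Z) = 1 := by
      rw [← hJF x, h1]
      simp
    have h3 : (x : M.NFFunctionField Z) = 1 := σZ.injective (by rw [h2, map_one])
    have h4 : x = 1 := Units.ext (by rw [h3, Units.val_one])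
    rw [h4, ofMul_one]
  · -- the image is `nfRationalImage S`
    ext ξ
    simp only [Set.mem_range, AddMonoidHom.mk'_apply]
    constructor
    · rintro ⟨a, rfl⟩
      generalize Additive.toMul a = x
      exact ⟨J x, F x, (hσNF (J x) _).2 ⟨(x : M.NFFunctionField Z), (hJF x).symm⟩, rfl⟩
    · rintro ⟨i, f, hf, rfl⟩
      obtain ⟨a, ha⟩ := (hσNF i _).1 hf
      have ha0 : a ≠ 0 := by
        rintro rfl
        rw [map_zero] at ha
        exact ((f : (M.FunctionField (S.V i))ˣ)).ne_zero ((σ i).injective (by rw [← ha, map_zero]))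
      exact ⟨Additive.ofMul (Units.mk0 a ha0), he₀ (Units.mk0 a ha0) i f (by rw [Units.val_mk0, ha])⟩

end FunctionField

/-! ### The closers of the named statements under the interface laws -/

/-- **`Thm19d_constants` under the interface laws** ("one constructs the subgroups
`k̄_NF^× ⊆ K_{Z_NF}^× ↪ lim_{→V} H¹(Π_V, μ_Ẑ(Π_U))` [...] via [...] Proposition 1.8, (i), (ii)", p. 37–38): the
NAMED statement of abc-iut-w5-d213's `Thm19KummerContainer.lean` from Prop. 1.8 (i)(ii), Prop. 1.6 (iii),
Rmk. 1.5.4 (i) and the injectivity row `Thm19d_inj` BY NAME, and — as ONE explicit hypothesis — the interface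
laws per directed system: unit restrictions `ρ` with the NATURALITY of the Kummer maps (GAP G-w5d213-1, the
shape of abc-iut-w5-d099's `thm19d_inj_of_naturality`), the tower of base fields `τ_i : k′_i → k̄` compatible
with `ρ`, detecting NF-constants (Def. 1.7 (ii)) and exhausting `k̄_NF`, "constants are regular units", and the
eventual existence of nonconstant NF-rational units (GAP G-w5d213-2). [cite: MochizukiAbsTopIII2015, Thm 1.9 (d) p.37] -/
theorem thm19d_constants_of_laws (h18i : M.Prop_1_8_i) (h18ii : M.Prop_1_8_ii)
    (h16u : M.Prop_1_6_iii_units) (h16k : M.Prop_1_6_iii_ker) (h154 : Rmk_1_5_4_i.{u})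
    (hinj : M.Thm19d_inj)
    (hlaws : ∀ (Z : M.Curve), M.IsThm19dInput Z → ∀ (ι : Type u) [Preorder ι] [Nonempty ι]
      [IsDirectedOrder ι] (S : CurveModel.NFComplementSystem M.toCurveModel Z ι),
      ∃ (ρ : ∀ ⦃i j : ι⦄, i ≤ j →
          (Additive (M.regularUnits (S.V i)) →+ Additive (M.regularUnits (S.V j))))
        (τ : ∀ i : ι, M.base (S.V i) →+* AlgebraicClosure (M.base Z))
        (hcreg : ∀ (i : ι) (c : (M.base (S.V i))ˣ),
          Units.map (algebraMap (M.base (S.V i)) (M.FunctionField (S.V i)) : _ →* _) c ∈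
            M.regularUnits (S.V i)),
        (∀ ⦃i j : ι⦄ (h : i ≤ j) (f : Additive (M.regularUnits (S.V i))),
            S.transition i j h (M.kummerLevel S i f) = M.kummerLevel S j (ρ h f)) ∧
          (∀ ⦃i j : ι⦄ (h : i ≤ j) (c : (M.base (S.V i))ˣ), ∃ c' : (M.base (S.V j))ˣ,
              τ j (c' : M.base (S.V j)) = τ i (c : M.base (S.V i)) ∧
                ρ h (Additive.ofMul ⟨_, hcreg i c⟩) = Additive.ofMul ⟨_, hcreg j c'⟩) ∧
          (∀ (i : ι) (c : (M.base (S.V i))ˣ),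
              M.IsNFConstant (S.V i) (c : M.base (S.V i)) ↔ τ i (c : M.base (S.V i)) ∈ M.kbarNF Z) ∧
          (∀ (i : ι) (a : AlgebraicClosure (M.base Z)), a ∈ M.kbarNF Z →
              ∃ j : ι, i ≤ j ∧ a ∈ Set.range (τ j)) ∧
          (∀ i : ι, ∃ (j : ι) (_ : i ≤ j) (g : M.regularUnits (S.V j)),
              M.IsNFRational (S.V j) ((g : (M.FunctionField (S.V j))ˣ) : M.FunctionField (S.V j)) ∧
                ¬ M.IsConstantUnit (g : (M.FunctionField (S.V j))ˣ))) :
    M.Thm19d_constants := by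
  intro Z hZ ι _ _ _ S
  obtain ⟨ρ, τ, hcreg, hnat, hτρ, hτNF, hτexh, hrich⟩ := hlaws Z hZ ι S
  have hρconst : ∀ ⦃i j : ι⦄ (h : i ≤ j) (c : (M.base (S.V i))ˣ)
      (hc : Units.map (algebraMap (M.base (S.V i)) (M.FunctionField (S.V i)) : _ →* _) c ∈
        M.regularUnits (S.V i)), M.IsNFConstant (S.V i) (c : M.base (S.V i)) →
      ∃ (c' : (M.base (S.V j))ˣ)
        (hc' : Units.map (algebraMap (M.base (S.V j)) (M.FunctionField (S.V j)) : _ →* _) c' ∈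
          M.regularUnits (S.V j)),
        M.IsNFConstant (S.V j) (c' : M.base (S.V j)) ∧
          ρ h (Additive.ofMul ⟨_, hc⟩) = Additive.ofMul ⟨_, hc'⟩ := by
    intro i j h c hc hcNF
    obtain ⟨c', hτ, hρ⟩ := hτρ h c
    exact ⟨c', hcreg j c', (hτNF j c').2 (by rw [hτ]; exact (hτNF i c).1 hcNF), hρ⟩
  have hset := M.constantPart_eq_nfConstantImage S h18i h18ii h16u h16k h154 hZ ρ hnat hρconst hrich
  obtain ⟨e, he, hr⟩ :=
    M.exists_constEmbedding S ρ hnat hcreg τ hτρ hτNF hτexh (hinj Z hZ ι S)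
  exact ⟨hset, e, he, hr.trans hset.symm⟩

/-- **`Thm19d_functionField` under the interface laws**: the NAMED statement of abc-iut-w5-d213's
`Thm19KummerContainer.lean` from Prop. 1.8 (i)(ii), Prop. 1.6 (iii), Rmk. 1.5.4 (i) and `Thm19d_inj` BY NAME,
and — as ONE explicit hypothesis — the interface laws per directed system: unit restrictions `ρ` with the
NATURALITY of the Kummer maps and their compatibility with NF-constants (GAP G-w5d213-1), the eventual existence
of nonconstant NF-rational units, the Def.-1.7 (ii) link "NF-constant ⟺ NF-rational constant function", and the
tower of function fields `σ_i : K_{V_i} → Ω ⊇ σ_Z(K_{Z_NF})` compatible with `ρ`, detecting NF-rationality,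
with every `f ∈ K_{Z_NF}^×` eventually a regular unit (GAP G-w5d213-2).
[cite: MochizukiAbsTopIII2015, Thm 1.9 (d) p.37] -/
theorem thm19d_functionField_of_laws (h18i : M.Prop_1_8_i) (h18ii : M.Prop_1_8_ii)
    (h16u : M.Prop_1_6_iii_units) (h16k : M.Prop_1_6_iii_ker) (h154 : Rmk_1_5_4_i.{u})
    (hinj : M.Thm19d_inj)
    (hlaws : ∀ (Z : M.Curve), M.IsThm19dInput Z → ∀ (ι : Type u) [Preorder ι] [Nonempty ι]
      [IsDirectedOrder ι] (S : CurveModel.NFComplementSystem M.toCurveModel Z ι),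
      ∃ (ρ : ∀ ⦃i j : ι⦄, i ≤ j →
          (Additive (M.regularUnits (S.V i)) →+ Additive (M.regularUnits (S.V j))))
        (Ω : Type u) (_ : Field Ω) (σ : ∀ i : ι, M.FunctionField (S.V i) →+* Ω)
        (σZ : M.NFFunctionField Z →+* Ω),
        (∀ ⦃i j : ι⦄ (h : i ≤ j) (f : Additive (M.regularUnits (S.V i))),
            S.transition i j h (M.kummerLevel S i f) = M.kummerLevel S j (ρ h f)) ∧
          (∀ ⦃i j : ι⦄ (h : i ≤ j) (c : (M.base (S.V i))ˣ)
              (hc : Units.map (algebraMap (M.base (S.V i)) (M.FunctionField (S.V i)) : _ →* _) c ∈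
                M.regularUnits (S.V i)), M.IsNFConstant (S.V i) (c : M.base (S.V i)) →
              ∃ (c' : (M.base (S.V j))ˣ)
                (hc' : Units.map (algebraMap (M.base (S.V j)) (M.FunctionField (S.V j)) : _ →* _) c' ∈
                  M.regularUnits (S.V j)),
                M.IsNFConstant (S.V j) (c' : M.base (S.V j)) ∧
                  ρ h (Additive.ofMul ⟨_, hc⟩) = Additive.ofMul ⟨_, hc'⟩) ∧
          (∀ i : ι, ∃ (j : ι) (_ : i ≤ j) (g : M.regularUnits (S.V j)),
              M.IsNFRational (S.V j) ((g : (M.FunctionField (S.V j))ˣ) : M.FunctionField (S.V j)) ∧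
                ¬ M.IsConstantUnit (g : (M.FunctionField (S.V j))ˣ)) ∧
          (∀ (i : ι) (c : (M.base (S.V i))ˣ), M.IsNFConstant (S.V i) (c : M.base (S.V i)) ↔
              M.IsNFRational (S.V i) (algebraMap (M.base (S.V i)) (M.FunctionField (S.V i)) c)) ∧
          (∀ ⦃i j : ι⦄ (h : i ≤ j) (f : M.regularUnits (S.V i)),
              σ j (((Additive.toMul (ρ h (Additive.ofMul f)) : M.regularUnits (S.V j)) :
                (M.FunctionField (S.V j))ˣ) : M.FunctionField (S.V j)) =
                σ i ((f : (M.FunctionField (S.V i))ˣ) : M.FunctionField (S.V i))) ∧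
          (∀ (i : ι) (g : M.FunctionField (S.V i)),
              M.IsNFRational (S.V i) g ↔ σ i g ∈ Set.range σZ) ∧
          (∀ (i : ι) (a : M.NFFunctionField Z), a ≠ 0 → ∃ j : ι, i ≤ j ∧
              ∃ f : M.regularUnits (S.V j),
                σ j ((f : (M.FunctionField (S.V j))ˣ) : M.FunctionField (S.V j)) = σZ a)) :
    M.Thm19d_functionField := by
  intro Z hZ ι _ _ _ S
  obtain ⟨ρ, Ω, _, σ, σZ, hnat, hρconst, hrich, hconst, hσρ, hσNF, hσexh⟩ := hlaws Z hZ ι S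
  have hset := M.functionFieldPart_eq_nfRationalImage S h18i h18ii h16u h16k h154 hZ ρ hnat hρconst
    hrich hconst
  obtain ⟨e, he, hr⟩ :=
    M.exists_functionFieldEmbedding S ρ hnat Ω σ hσρ σZ hσNF hσexh (hinj Z hZ ι S)
  exact ⟨hset, e, he, hr.trans hset.symm⟩

end IntrinsicKummerModel

end Literature.AnabelianGeometry.AbsoluteAnabelian.AbsTopIII
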